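import Literature.AlgebraicGeometry.Limits.FiniteTypeModel
import Mathlib.AlgebraicGeometry.Limits
import Mathlib.AlgebraicGeometry.Morphisms.ClosedImmersion
import Mathlib.AlgebraicGeometry.Morphisms.Separated
import Mathlib.AlgebraicGeometry.Morphisms.FiniteType
import Mathlib.CategoryTheory.Limits.Shapes.Pullback.Pasting
import Mathlib.FieldTheory.PerfectClosure
import HarnessLib

/-!
# `PAlteration.Assembly` (stmt-ResolutionOfSingularities-0553): embedding a `K`-scheme into the base change of a `k`-scheme of finite type

Route `ResolutionOfSingularities/pAlteration`, item `Assembly` (stmt-0553); helper file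
(`--supports`). Set-up of the descent in Theorem B. Let `k` be a field of characteristic `p`,
`K = k^{p^{-∞}}` its perfect closure, `X → Spec k` separated of finite type and
`ρ : R → X_K = Spec K ×_k X` separated, quasi-compact and locally of finite type. Then there are
a separated quasi-compact `k`-scheme of finite type `Q → Spec k` with a `k`-morphism `Q → X` and a
CLOSED IMMERSION `m : R ↪ Spec K ×_k Q` over `X_K` (`exists_closedImmersion_baseChange`).

Construction: a finite type model `R ↪ Y₀ ×_{A₀} Spec K` over a finitely generated ring
`A₀ ⊆ K` (`Literature.AlgebraicGeometry.Limits.exists_finiteTypeModel`), the `k`-scheme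
`W = Y₀ ×_ℤ Spec k`, `Q = W ×_k X`, and `m = (R → Spec K, (R → W, R → X))`; `m` is a closed
immersion because its composite with the separated projection `Spec K ×_k Q → Spec K ×_k W` is
`R ↪ Y₀ ×_{A₀} Spec K ↪ Y₀ ×_ℤ Spec K ≅ Spec K ×_k W` (the middle map is the base change of the
diagonal of the affine `Spec A₀ → Spec ℤ`).
-/

-- single-problem summit: the doubled namespace component `ResolutionOfSingularities` is forced
set_option linter.dupNamespace false

noncomputable section

open CategoryTheory CategoryTheory.Limits AlgebraicGeometry TopologicalSpace

namespace Summit.ResolutionOfSingularities.ResolutionOfSingularities.Theorems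

-- as in Mathlib's pullback API for schemes (`Morphisms/SchemeTheoreticallyDominant`)
set_option backward.isDefEq.respectTransparency false in
/-- **Embedding into the base change of a `k`-scheme of finite type** (see the module
docstring). [folklore] -/
theorem exists_closedImmersion_baseChange (p : ℕ) [Fact p.Prime] {k : Type} [Field k]
    [CharP k p] {X : Scheme.{0}} (f : X ⟶ Spec (.of k)) [IsSeparated f] [LocallyOfFiniteType f]
    [QuasiCompact f] {R : Scheme.{0}}
    (ρ : R ⟶ pullback (Spec.map (CommRingCat.ofHom (PerfectClosure.of k p))) f)
    [IsSeparated ρ] [LocallyOfFiniteType ρ] [QuasiCompact ρ] :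
    ∃ (Q : Over (Spec (CommRingCat.of k))) (prX : Q.left ⟶ X)
      (m : R ⟶ pullback (Spec.map (CommRingCat.ofHom (PerfectClosure.of k p))) Q.hom),
      QuasiCompact Q.hom ∧ IsSeparated Q.hom ∧ LocallyOfFiniteType Q.hom ∧
        IsClosedImmersion m ∧ prX ≫ f = Q.hom ∧
        m ≫ pullback.fst _ _ = ρ ≫ pullback.fst _ _ ∧
        m ≫ pullback.snd _ _ ≫ prX = ρ ≫ pullback.snd _ _ := by
  -- notation: `σk = Spec K → Spec k`, `gR = R → Spec K`
  let σk := CommRingCat.ofHom (PerfectClosure.of k p)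
  let gR := ρ ≫ pullback.fst (Spec.map σk) f
  haveI : IsSeparated gR := inferInstanceAs (IsSeparated (ρ ≫ pullback.fst (Spec.map σk) f))
  haveI : LocallyOfFiniteType gR :=
    inferInstanceAs (LocallyOfFiniteType (ρ ≫ pullback.fst (Spec.map σk) f))
  haveI : QuasiCompact gR := inferInstanceAs (QuasiCompact (ρ ≫ pullback.fst (Spec.map σk) f))
  -- a finite type model of `R` over a finitely generated subring `A₀ ⊆ K`
  obtain ⟨A₀, _, φ, Y₀, p₀, j, -, hfg, -, hsep, hlft, hqc, hj, hjg⟩ :=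
    Literature.AlgebraicGeometry.Limits.exists_finiteTypeModel gR
  haveI := hsep; haveI := hlft; haveI := hqc; haveI := hj
  -- everything over `Spec ℤ`
  let zA : Spec (CommRingCat.of A₀) ⟶ Spec (CommRingCat.of ℤ) :=
    Spec.map (CommRingCat.ofHom (algebraMap ℤ A₀))
  let zk : Spec (CommRingCat.of k) ⟶ Spec (CommRingCat.of ℤ) :=
    Spec.map (CommRingCat.ofHom (algebraMap ℤ k))
  have hterm : ∀ {T : Scheme.{0}} (a b : T ⟶ Spec (CommRingCat.of ℤ)), a = b :=
    fun a b => specZIsTerminal.hom_ext a b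
  -- the `k`-scheme `W = Y₀ ×_ℤ Spec k` and `Q = W ×_k X`
  let W := pullback (p₀ ≫ zA) zk
  let wk : W ⟶ Spec (CommRingCat.of k) := pullback.snd (p₀ ≫ zA) zk
  let QX := pullback wk f
  let prX : QX ⟶ X := pullback.snd wk f
  let Q : Over (Spec (CommRingCat.of k)) := Over.mk (prX ≫ f)
  -- the morphism `m`
  let mW : R ⟶ W := pullback.lift (j ≫ pullback.fst p₀ (Spec.map (CommRingCat.ofHom φ)))
    (gR ≫ Spec.map σk) (hterm _ _)
  have hcondX : pullback.snd (Spec.map σk) f ≫ f = pullback.fst (Spec.map σk) f ≫ Spec.map σk :=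
    pullback.condition.symm
  have w₂ : mW ≫ wk = (ρ ≫ pullback.snd (Spec.map σk) f) ≫ f := by
    rw [pullback.lift_snd]
    simp only [gR, Category.assoc]
    rw [hcondX]
  let mQ : R ⟶ QX := pullback.lift mW (ρ ≫ pullback.snd (Spec.map σk) f) w₂
  have w₁ : gR ≫ Spec.map σk = mQ ≫ Q.hom := by
    change gR ≫ Spec.map σk = mQ ≫ prX ≫ f
    rw [pullback.lift_snd_assoc]
    simp only [gR, Category.assoc]
    rw [hcondX]
  let m : R ⟶ pullback (Spec.map σk) Q.hom := pullback.lift gR mQ w₁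
  -- instances on `Q`
  haveI : LocallyOfFiniteType zA :=
    (HasRingHomProperty.Spec_iff (P := @LocallyOfFiniteType)).mpr
      (RingHom.finiteType_algebraMap.mpr hfg)
  haveI : IsSeparated wk := inferInstance
  haveI : QuasiCompact wk := inferInstance
  haveI : LocallyOfFiniteType wk := inferInstance
  have hQqc : QuasiCompact Q.hom := inferInstanceAs (QuasiCompact (prX ≫ f))
  have hQsep : IsSeparated Q.hom := inferInstanceAs (IsSeparated (prX ≫ f))
  have hQlft : LocallyOfFiniteType Q.hom := inferInstanceAs (LocallyOfFiniteType (prX ≫ f))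
  refine ⟨Q, prX, m, hQqc, hQsep, hQlft, ?_, rfl, pullback.lift_fst _ _ _, ?_⟩
  swap
  · change pullback.lift gR mQ w₁ ≫ pullback.snd _ _ ≫ prX = ρ ≫ pullback.snd (Spec.map σk) f
    rw [pullback.lift_snd_assoc]
    exact pullback.lift_snd _ _ _
  -- `m` is a closed immersion: compare with `j` through `Spec K ×_k W`
  let r : pullback (Spec.map σk) Q.hom ⟶ pullback (Spec.map σk) wk :=
    pullback.map _ _ _ _ (𝟙 _) (pullback.fst wk f) (𝟙 _) (by simp)
      (by rw [Category.comp_id]; exact pullback.condition.symm)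
  let m' : R ⟶ pullback (Spec.map σk) wk := pullback.lift gR mW (by rw [pullback.lift_snd])
  have hmr : m ≫ r = m' := by
    apply pullback.hom_ext
    · simp [m, r, m']
    · simp [m, r, m', mQ]
  haveI hQXsep : IsSeparated Q.hom := hQsep
  haveI : IsSeparated (r ≫ pullback.fst (Spec.map σk) wk) := by
    have : r ≫ pullback.fst (Spec.map σk) wk = pullback.fst (Spec.map σk) Q.hom := by
      simp [r]
    rw [this]; infer_instance
  haveI : IsSeparated r := IsSeparated.of_comp r (pullback.fst (Spec.map σk) wk)
  -- `Spec K ×_k W ≅ Y₀ ×_ℤ Spec K ⊇ Y₀ ×_{A₀} Spec K`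
  have hz : Spec.map σk ≫ zk = Spec.map (CommRingCat.ofHom φ) ≫ zA := hterm _ _
  let e : pullback (Spec.map σk) wk ≅ pullback (p₀ ≫ zA) (Spec.map (CommRingCat.ofHom φ) ≫ zA) :=
    pullbackSymmetry _ _ ≪≫ pullbackLeftPullbackSndIso (p₀ ≫ zA) zk (Spec.map σk) ≪≫
      pullback.congrHom rfl hz
  let c := pullback.mapDesc p₀ (Spec.map (CommRingCat.ofHom φ)) zA
  haveI : IsClosedImmersion c := inferInstance
  have hme : m' ≫ e.hom = j ≫ c := by
    apply pullback.hom_ext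
    · simp [m', e, c, mW, wk]
    · simp [m', e, c, hjg, wk]
  haveI : IsClosedImmersion (m' ≫ e.hom) := by rw [hme]; infer_instance
  haveI : IsClosedImmersion m' := IsClosedImmersion.of_comp m' e.hom
  haveI : IsClosedImmersion (m ≫ r) := by rw [hmr]; infer_instance
  exact IsClosedImmersion.of_comp m r

end Summit.ResolutionOfSingularities.ResolutionOfSingularities.Theorems

end
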